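import Summits.ValiantsHypothesis.ValiantsHypothesis.Theses.BorderApolarity
import Literature.Computability.AlgebraicComplexity.ApolarityAction
import Summits.ValiantsHypothesis.ValiantsHypothesis.Theorems.ToricFixedPoints.Negative.WithoutOrbitFalse

/-!
# Line `bb-cell-state-polytope` — crux `BorderApolarity.ToricFixedPoints` (stmt-ValiantsHypothesis-5779)

Lead's skeleton (prover-line-stmt-ValiantsHypothesis-5779-0), reshaped from the planner's
`Cruxes/ToricFixedPoints/Lines/bb-cell-state-polytope.lean` (sha 49723aab3396): the four stubs are the
planner's S1–S4 with every file-local definition (`initialSpan`, `IsGraded`, `GenericFor`, `filtRank`,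
`SetKLim`, `InZdet`, `H0Stable`, `IsToric`) UNFOLDED into the signatures, so that each stub is stated over
Mathlib + `Literature.Computability.AlgebraicComplexity` only and lands as a pure proof file under
`Theorems/` (`--supports stmt-ValiantsHypothesis-5779`).  The composition `ToricFixedPoints_of` is sorry-free
and concludes the route decl `Summit.ValiantsHypothesis.ValiantsHypothesis.Theses.BorderApolarity.ToricFixedPoints`
BY NAME from the four registered stubs.

## Dictionary (informal names ↔ the inlined expressions)

* `in_w(A)` (initial span, LOWEST `w`-weight): `Submodule.span ℂ {D | ∃ E ∈ A, ∃ ν : ℤ,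
  D = weightedHomogeneousComponent w ν E ∧ ∀ ν' < ν, weightedHomogeneousComponent w ν' E = 0}`.
* `J` is `μ`-graded (degrees `≤ m`): `∀ k ≤ m, ∀ D ∈ J k, ∀ ν, weightedHomogeneousComponent μ ν D ∈ J k`.
* `μ` generic for `J`: `μ`-graded, and `μ` separates every pair of degree-`k` exponents (`k ≤ m`) separated by
  some `μ₁` grading `J` (regular in the cocharacter lattice of `Stab_{T_W}(J)`).
* filtration rank `rk_{μ,ν}(A) = dim span (A ∩ S_{≥ν})`:
  `Module.finrank ℂ ↥(Submodule.span ℂ (A ∩ {D | ∀ e ∈ D.support, ν ≤ Finsupp.weight μ e}))`.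
* `Y_t → J` (set Kuratowski limit, degrees `≤ m`): clauses (Li) ∧ (Ls) of `IsBorderApolarLimit` with `Ann_k(P t)`
  replaced by `Y t k`.
* `J ∈ Z_det` (sequentially): `∃ P, (∀ t, P t ∈ GL·det_m) ∧ IsBorderApolarLimit m P J`.
* `H₀(n,m)`-stable: the crux's stability clause verbatim (with its `let rk := …`).
* `J` toric: `∃ u g w, ∀ k ≤ m, ∀ D, D ∈ J k ↔ linSubst uᵀ D ∈ in_w(Ann_k(g·det_m))`.

## The line

S1 `stub_toricLimitIsInitial` (true, M): the Kuratowski limit along the toric curve `u·diag((t+2)^w)·f` exists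
and is `{D : uᵀD ∈ in_w(Ann_k f)}`.  S2 `stub_cellApproachable` (bet): an `H₀`-fixed point of `Z_det` is
approachable from the orbit inside its own Białynicki-Birula cell for a cocharacter generic for it.  S3
`stub_cellRetraction` (true, L): on a constant-filtration-rank stratum the retraction `in_μ` is sequentially
continuous.  S4 `stub_cellClosure` (bet, HARDEST): an `H₀`-fixed point of `Z_det` that is the limit of the
same-chamber toric points `in_μ(Ann(P'_t))` of its own component is toric.  S2 and S4 are NECESSARY
consequences of the crux (given the `u = 1` absorption), so `¬S2` or `¬S4` refutes the crux itself.

Disproof honoured: `Negative.toricFixedPoints_false_without_orbit` (imported) — the orbit clause is load-bearing;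
it is carried verbatim into S2 and S4 (`∃ P, (∀ t, P t ∈ GL·det_m) ∧ …`).  S1/S3 need no orbit hypothesis.
-/

noncomputable section

set_option linter.dupNamespace false

namespace Summit.ValiantsHypothesis.ValiantsHypothesis.Cruxes.ToricFixedPoints.BbCellStatePolytope

open scoped BigOperators Matrix Topology
open Filter MvPolynomial
open Literature.Computability.AlgebraicComplexity
open Summit.ValiantsHypothesis.ValiantsHypothesis.Theses.BorderApolarity (ToricFixedPoints)

/-! ## §1 Registered stubs (the ONLY sorries of this file; all statements def-free) -/

/-- S1 — TORIC KURATOWSKI LIMIT = TRANSLATED LOWEST-WEIGHT INITIAL SPAN (true, M).  Along the toric curve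
`t ↦ u·diag((t+2)^w)·f` the degree-wise Kuratowski limit of the annihilators exists and equals
`{D : uᵀ·D ∈ in_w(Ann_k f)}`: `Ann(A·f) = {D : Aᵀ D ∈ Ann f}` (`apolarAction_linSubst_eq_zero_iff`), so
`Ann_k(diag(c_t)·f) = {Σ a_e (t+2)^{−⟨w,e⟩} ∂^e : Σ a_e ∂^e ∈ Ann_k f}`; `lim inf ⊇` lowest forms; an echelon basis
of `Ann_k f` with independent lowest forms (exists since `dim in_w A = dim A`) controls every subsequential limit.
Stated for an arbitrary polynomial `f`. [folklore] -/
theorem stub_toricLimitIsInitial :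
    ∀ (m : ℕ) (u : Matrix.GeneralLinearGroup (Fin m × Fin m) ℂ) (w : Fin m × Fin m → ℤ)
      (f : MvPolynomial (Fin m × Fin m) ℂ),
      IsBorderApolarLimit m
        (fun t : ℕ => linSubst (Fin m × Fin m) ℂ (u : Matrix (Fin m × Fin m) (Fin m × Fin m) ℂ)
          (linSubst (Fin m × Fin m) ℂ (Matrix.diagonal fun i : Fin m × Fin m => ((t : ℂ) + 2) ^ (w i)) f))
        (fun k => {D | linSubst (Fin m × Fin m) ℂ (u : Matrix (Fin m × Fin m) (Fin m × Fin m) ℂ)ᵀ D ∈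
          Submodule.span ℂ {D' : MvPolynomial (Fin m × Fin m) ℂ | ∃ E ∈ annihilatorOfDegree f k, ∃ ν : ℤ,
            D' = weightedHomogeneousComponent w ν E ∧
              ∀ ν' : ℤ, ν' < ν → weightedHomogeneousComponent w ν' E = 0}}) := by
  sorry

/-- S2 — BIAŁYNICKI-BIRULA CELL APPROACHABILITY OF `H₀`-FIXED POINTS OF `Z_det` (bet 1 of the line).  For
`3 ≤ n ≤ m`, every `H₀(n,m)`-stable border-apolar limit `J` of a sequence in `GL·det_m` admits a cocharacter `μ`
of the diagonal torus that grades `J` and is generic for `J`, and an orbit sequence `P'_t ∈ GL·det_m` with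
`Ann_•(P'_t) → J` whose `μ`-filtration ranks equal those of `J` for every `t`, `k ≤ m`, `ν`
(i.e. `(Ann_k(P'_t))_k` lies in the BB cell of `J`'s fixed component).  Necessary for the crux (refine the
cocharacter of the toric curve inside `X_*(Stab_{T_W} J)` after the `u = 1` absorption). [folklore] -/
theorem stub_cellApproachable :
    ∀ (n m : ℕ) [NeZero m], 3 ≤ n → n ≤ m →
    let rk := fun (p : Fin m × Fin m) =>
      (if (m - n ≤ (p.1 : ℕ) ∧ m - n ≤ (p.2 : ℕ)) ∨ p = (0, 0) then 0 else m * m) + ((p.1 : ℕ) * m + (p.2 : ℕ));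
    ∀ J : ℕ → Set (MvPolynomial (Fin m × Fin m) ℂ),
      (∃ P : ℕ → MvPolynomial (Fin m × Fin m) ℂ,
        (∀ t : ℕ, P t ∈ glOrbit (Fin m × Fin m) ℂ (detPoly (Fin m) ℂ)) ∧ IsBorderApolarLimit m P J) →
      (∀ A : Matrix.GeneralLinearGroup (Fin m × Fin m) ℂ,
        let M : Matrix (Fin m × Fin m) (Fin m × Fin m) ℂ := A;
        (∀ i j : Fin m × Fin m, M j i ≠ 0 → rk j ≤ rk i) →
        (∀ i j : Fin m × Fin m, ((m - n ≤ (i.1 : ℕ) ∧ m - n ≤ (i.2 : ℕ)) ∨ i = (0, 0)) → j ≠ i → M j i = 0) →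
        (∀ i k j l : Fin m, m - n ≤ (i : ℕ) → m - n ≤ (k : ℕ) → m - n ≤ (j : ℕ) → m - n ≤ (l : ℕ) →
          M (i, j) (i, j) * M (k, l) (k, l) = M (i, l) (i, l) * M (k, j) (k, j)) →
        M (0, 0) (0, 0) ^ (m - n) * ∏ i ∈ Finset.univ.filter (fun i : Fin m => m - n ≤ (i : ℕ)), M (i, i) (i, i) = 1 →
        ∀ k ≤ m, ∀ D ∈ J k, linSubst (Fin m × Fin m) ℂ Mᵀ D ∈ J k) →
      ∃ (μ : Fin m × Fin m → ℤ) (P' : ℕ → MvPolynomial (Fin m × Fin m) ℂ),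
        ((∀ k ≤ m, ∀ D ∈ J k, ∀ ν : ℤ, weightedHomogeneousComponent μ ν D ∈ J k) ∧
          ∀ μ₁ : Fin m × Fin m → ℤ, (∀ k ≤ m, ∀ D ∈ J k, ∀ ν : ℤ, weightedHomogeneousComponent μ₁ ν D ∈ J k) →
            ∀ k ≤ m, ∀ e e' : (Fin m × Fin m) →₀ ℕ, e.degree = k → e'.degree = k →
              Finsupp.weight μ₁ e ≠ Finsupp.weight μ₁ e' → Finsupp.weight μ e ≠ Finsupp.weight μ e') ∧
        (∀ t : ℕ, P' t ∈ glOrbit (Fin m × Fin m) ℂ (detPoly (Fin m) ℂ)) ∧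
        IsBorderApolarLimit m P' J ∧
        (∀ t : ℕ, ∀ k ≤ m, ∀ ν : ℤ,
          Module.finrank ℂ ↥(Submodule.span ℂ (annihilatorOfDegree (P' t) k ∩
            {D : MvPolynomial (Fin m × Fin m) ℂ | ∀ e ∈ D.support, ν ≤ Finsupp.weight μ e})) =
          Module.finrank ℂ ↥(Submodule.span ℂ (J k ∩
            {D : MvPolynomial (Fin m × Fin m) ℂ | ∀ e ∈ D.support, ν ≤ Finsupp.weight μ e}))) := by
  sorry

/-- S3 — SEQUENTIAL CONTINUITY OF THE BB RETRACTION ON A CONSTANT-RANK STRATUM (true, L).  If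
`Ann_•(P'_t) → J` degree-wise (`k ≤ m`), `J` is `μ`-graded, and for all `t`, `k ≤ m`, `ν` the `μ`-filtration rank
`dim span(Ann_k(P'_t) ∩ S_{≥ν})` equals that of `J k`, then the initial spans `in_μ(Ann_k(P'_t))` Kuratowski-converge
to `J` as well (`A_t ∩ S_{≥ν} → J_k ∩ S_{≥ν}` by sequential compactness of the Grassmannian and the pinned
dimension; project to weight `ν`; sum over the finitely many weights of degree-`k` monomials).  No orbit or
fixedness hypothesis. [folklore] -/
theorem stub_cellRetraction :
    ∀ (m : ℕ) (J : ℕ → Set (MvPolynomial (Fin m × Fin m) ℂ)) (μ : Fin m × Fin m → ℤ)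
      (P' : ℕ → MvPolynomial (Fin m × Fin m) ℂ),
      IsBorderApolarLimit m P' J →
      (∀ k ≤ m, ∀ D ∈ J k, ∀ ν : ℤ, weightedHomogeneousComponent μ ν D ∈ J k) →
      (∀ t : ℕ, ∀ k ≤ m, ∀ ν : ℤ,
          Module.finrank ℂ ↥(Submodule.span ℂ (annihilatorOfDegree (P' t) k ∩
            {D : MvPolynomial (Fin m × Fin m) ℂ | ∀ e ∈ D.support, ν ≤ Finsupp.weight μ e})) =
          Module.finrank ℂ ↥(Submodule.span ℂ (J k ∩
            {D : MvPolynomial (Fin m × Fin m) ℂ | ∀ e ∈ D.support, ν ≤ Finsupp.weight μ e}))) →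
      (∀ k ≤ m, ∀ D ∈ J k, ∃ Ds : ℕ → MvPolynomial (Fin m × Fin m) ℂ,
          (∀ t, Ds t ∈ Submodule.span ℂ {D' : MvPolynomial (Fin m × Fin m) ℂ |
              ∃ E ∈ annihilatorOfDegree (P' t) k, ∃ ν : ℤ, D' = weightedHomogeneousComponent μ ν E ∧
                ∀ ν' : ℤ, ν' < ν → weightedHomogeneousComponent μ ν' E = 0}) ∧
            Filter.Tendsto (fun t => coeffVec (Ds t)) Filter.atTop (nhds (coeffVec D))) ∧
      (∀ k ≤ m, ∀ (D : MvPolynomial (Fin m × Fin m) ℂ) (φ : ℕ → ℕ) (Ds : ℕ → MvPolynomial (Fin m × Fin m) ℂ),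
          StrictMono φ →
          (∀ t, Ds t ∈ Submodule.span ℂ {D' : MvPolynomial (Fin m × Fin m) ℂ |
              ∃ E ∈ annihilatorOfDegree (P' (φ t)) k, ∃ ν : ℤ, D' = weightedHomogeneousComponent μ ν E ∧
                ∀ ν' : ℤ, ν' < ν → weightedHomogeneousComponent μ ν' E = 0}) →
          Filter.Tendsto (fun t => coeffVec (Ds t)) Filter.atTop (nhds (coeffVec D)) → D ∈ J k) := by
  sorry

/-- S4 — CLOSEDNESS OF THE SAME-CHAMBER TORIC LOCUS AT `H₀`-FIXED POINTS (bet 2 of the line, HARDEST).  For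
`3 ≤ n ≤ m`: an `H₀(n,m)`-stable point `J` of `Z_det_m`, a cocharacter `μ` grading `J` and generic for `J`, and an
orbit sequence `P'_t ∈ GL·det_m` with `Ann_•(P'_t) → J` inside `J`'s `μ`-cell (filtration ranks pinned) whose
retracted points `in_μ(Ann_•(P'_t))` (toric points of `J`'s own fixed component and chamber) also converge to `J`
— then `J` is TORIC: `J_k = {D : uᵀD ∈ in_w(Ann_k(g·det_m))}` (`k ≤ m`) for some `u, g ∈ GL`, `w`.  "Closure of the
union versus union of the closures"; necessary for the crux; first computable instance `(n,m) = (3,3)`, sink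
component of a generic rank-one cocharacter. [folklore] -/
theorem stub_cellClosure :
    ∀ (n m : ℕ) [NeZero m], 3 ≤ n → n ≤ m →
    let rk := fun (p : Fin m × Fin m) =>
      (if (m - n ≤ (p.1 : ℕ) ∧ m - n ≤ (p.2 : ℕ)) ∨ p = (0, 0) then 0 else m * m) + ((p.1 : ℕ) * m + (p.2 : ℕ));
    ∀ J : ℕ → Set (MvPolynomial (Fin m × Fin m) ℂ),
      (∃ P : ℕ → MvPolynomial (Fin m × Fin m) ℂ,
        (∀ t : ℕ, P t ∈ glOrbit (Fin m × Fin m) ℂ (detPoly (Fin m) ℂ)) ∧ IsBorderApolarLimit m P J) →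
      (∀ A : Matrix.GeneralLinearGroup (Fin m × Fin m) ℂ,
        let M : Matrix (Fin m × Fin m) (Fin m × Fin m) ℂ := A;
        (∀ i j : Fin m × Fin m, M j i ≠ 0 → rk j ≤ rk i) →
        (∀ i j : Fin m × Fin m, ((m - n ≤ (i.1 : ℕ) ∧ m - n ≤ (i.2 : ℕ)) ∨ i = (0, 0)) → j ≠ i → M j i = 0) →
        (∀ i k j l : Fin m, m - n ≤ (i : ℕ) → m - n ≤ (k : ℕ) → m - n ≤ (j : ℕ) → m - n ≤ (l : ℕ) →
          M (i, j) (i, j) * M (k, l) (k, l) = M (i, l) (i, l) * M (k, j) (k, j)) →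
        M (0, 0) (0, 0) ^ (m - n) * ∏ i ∈ Finset.univ.filter (fun i : Fin m => m - n ≤ (i : ℕ)), M (i, i) (i, i) = 1 →
        ∀ k ≤ m, ∀ D ∈ J k, linSubst (Fin m × Fin m) ℂ Mᵀ D ∈ J k) →
      ∀ (μ : Fin m × Fin m → ℤ) (P' : ℕ → MvPolynomial (Fin m × Fin m) ℂ),
        ((∀ k ≤ m, ∀ D ∈ J k, ∀ ν : ℤ, weightedHomogeneousComponent μ ν D ∈ J k) ∧
          ∀ μ₁ : Fin m × Fin m → ℤ, (∀ k ≤ m, ∀ D ∈ J k, ∀ ν : ℤ, weightedHomogeneousComponent μ₁ ν D ∈ J k) →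
            ∀ k ≤ m, ∀ e e' : (Fin m × Fin m) →₀ ℕ, e.degree = k → e'.degree = k →
              Finsupp.weight μ₁ e ≠ Finsupp.weight μ₁ e' → Finsupp.weight μ e ≠ Finsupp.weight μ e') →
        (∀ t : ℕ, P' t ∈ glOrbit (Fin m × Fin m) ℂ (detPoly (Fin m) ℂ)) →
        IsBorderApolarLimit m P' J →
        (∀ t : ℕ, ∀ k ≤ m, ∀ ν : ℤ,
          Module.finrank ℂ ↥(Submodule.span ℂ (annihilatorOfDegree (P' t) k ∩
            {D : MvPolynomial (Fin m × Fin m) ℂ | ∀ e ∈ D.support, ν ≤ Finsupp.weight μ e})) =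
          Module.finrank ℂ ↥(Submodule.span ℂ (J k ∩
            {D : MvPolynomial (Fin m × Fin m) ℂ | ∀ e ∈ D.support, ν ≤ Finsupp.weight μ e}))) →
        ((∀ k ≤ m, ∀ D ∈ J k, ∃ Ds : ℕ → MvPolynomial (Fin m × Fin m) ℂ,
            (∀ t, Ds t ∈ Submodule.span ℂ {D' : MvPolynomial (Fin m × Fin m) ℂ |
                ∃ E ∈ annihilatorOfDegree (P' t) k, ∃ ν : ℤ, D' = weightedHomogeneousComponent μ ν E ∧
                  ∀ ν' : ℤ, ν' < ν → weightedHomogeneousComponent μ ν' E = 0}) ∧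
              Filter.Tendsto (fun t => coeffVec (Ds t)) Filter.atTop (nhds (coeffVec D))) ∧
          (∀ k ≤ m, ∀ (D : MvPolynomial (Fin m × Fin m) ℂ) (φ : ℕ → ℕ) (Ds : ℕ → MvPolynomial (Fin m × Fin m) ℂ),
            StrictMono φ →
            (∀ t, Ds t ∈ Submodule.span ℂ {D' : MvPolynomial (Fin m × Fin m) ℂ |
                ∃ E ∈ annihilatorOfDegree (P' (φ t)) k, ∃ ν : ℤ, D' = weightedHomogeneousComponent μ ν E ∧
                  ∀ ν' : ℤ, ν' < ν → weightedHomogeneousComponent μ ν' E = 0}) →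
            Filter.Tendsto (fun t => coeffVec (Ds t)) Filter.atTop (nhds (coeffVec D)) → D ∈ J k)) →
        ∃ (u g : Matrix.GeneralLinearGroup (Fin m × Fin m) ℂ) (w : Fin m × Fin m → ℤ),
          ∀ k ≤ m, ∀ D : MvPolynomial (Fin m × Fin m) ℂ,
            D ∈ J k ↔ linSubst (Fin m × Fin m) ℂ (u : Matrix (Fin m × Fin m) (Fin m × Fin m) ℂ)ᵀ D ∈
              Submodule.span ℂ {D' : MvPolynomial (Fin m × Fin m) ℂ |
                ∃ E ∈ annihilatorOfDegree (linSubst (Fin m × Fin m) ℂ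
                    (g : Matrix (Fin m × Fin m) (Fin m × Fin m) ℂ) (detPoly (Fin m) ℂ)) k, ∃ ν : ℤ,
                  D' = weightedHomogeneousComponent w ν E ∧
                    ∀ ν' : ℤ, ν' < ν → weightedHomogeneousComponent w ν' E = 0} := by
  sorry

/-! ## §2 Glue (sorry-free) -/

/-- Border-apolar limits only see membership in `J k` for `k ≤ m`: transfer along a pointwise `↔`. [folklore] -/
theorem isBorderApolarLimit_congr_right {m : ℕ} {P : ℕ → MvPolynomial (Fin m × Fin m) ℂ}
    {J J' : ℕ → Set (MvPolynomial (Fin m × Fin m) ℂ)} (h : IsBorderApolarLimit m P J')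
    (hJ : ∀ k ≤ m, ∀ D : MvPolynomial (Fin m × Fin m) ℂ, D ∈ J k ↔ D ∈ J' k) :
    IsBorderApolarLimit m P J := by
  refine ⟨fun k hk D hD => h.1 k hk D ((hJ k hk D).1 hD), fun k hk D φ Ds hφ hDs hlim => ?_⟩
  exact (hJ k hk D).2 (h.2 k hk D φ Ds hφ hDs hlim)

/-- COMPOSITION (kernel-checked, no `sorry`): the four registered stubs imply the crux
`BorderApolarity.ToricFixedPoints` BY NAME.  Unfold the crux's two `let`s (its inline `act` is `apolarAction`
and its two limit conjuncts are `IsBorderApolarLimit` token for token); S2 supplies the generic cocharacter `μ`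
and the in-cell orbit sequence `P'`; S3 the convergence of the retracted points `in_μ(Ann_•(P'_t))`; S4
toricity `J_k = {D : uᵀD ∈ in_w Ann_k(g·det_m)}`; S1 identifies this with the Kuratowski limit along the
crux's toric curve `u·diag((t+2)^w)·g·det_m`. [folklore] -/
theorem ToricFixedPoints_of : ToricFixedPoints := by
  intro n m inst h3n hnm
  dsimp only
  intro P J hP hlim hstab
  have hlim' : IsBorderApolarLimit m P J := hlim
  -- S2: generic cocharacter + in-cell orbit sequence
  have h2 := @stub_cellApproachable n m inst h3n hnm
  dsimp only at h2
  obtain ⟨μ, P', hgen, hP', hlimP', hrk⟩ := h2 J ⟨P, hP, hlim'⟩ hstab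
  -- S3: the retracted points converge to J
  have hconv := stub_cellRetraction m J μ P' hlimP' hgen.1 hrk
  -- S4: J is toric
  have h4 := @stub_cellClosure n m inst h3n hnm
  dsimp only at h4
  obtain ⟨u, g, w, htor⟩ := h4 J ⟨P, hP, hlim'⟩ hstab μ P' hgen hP' hlimP' hrk hconv
  -- S1: toric = Kuratowski limit along the toric curve
  refine ⟨u, g, w, ?_⟩
  have key := stub_toricLimitIsInitial m u w
    (linSubst (Fin m × Fin m) ℂ (g : Matrix (Fin m × Fin m) (Fin m × Fin m) ℂ) (detPoly (Fin m) ℂ))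
  exact isBorderApolarLimit_congr_right key htor

end Summit.ValiantsHypothesis.ValiantsHypothesis.Cruxes.ToricFixedPoints.BbCellStatePolytope

end
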